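import Summits.Ventures.HSemireg.WedgeBoxPurity

/-!
# Venture HSemireg — the purity locus of the honest box (2/2): the rank on and off the determinant locus

HONEST FRAMING. Part of the Lean index of the computation cell `pub-hsemireg` (second enclosure wave, cut by seat p6 in the
conventions of seat p3's ENCLOSURE-PLAN-p3.md / build.py from th-7's kernel assets).  Finite-dimensional exterior algebra over a field ONLY:
no variety, no cohomology theory, no semiregularity map is constructed here; nothing here says that HC / HC_CM / HC_AV holds;
no Literature fact is declared or used.  The geometric DICTIONARY (why these ranks are the `HT`-side box ranks of the cell's
STRUCTURE.md §1 / theory/FORMULA-N.md) lives in theory/FORMULA-N-th7.md PART B §A.3 / §N and is NOT asserted in Lean.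

th-7's PART V — the degree-`n` PURITY LOCUS of the honest box for a GENERAL `2 × 2` coefficient matrix (theory/th7/WeilPurity.lean v3.2 sha256/16 fa4f1543e639b652 (th-7 g5, 22:21Z 2026-08-22; ×2 farm rc 0 + axioms standard at p3 g9 21:58Z (v3.1 prefix), th-2 g22 22:27Z, p6 g7 22:32Z; statement reads + independent exact numerics p6 g6 X2-WEILPURITY-p6g6.md a0873432c5a1b400 (PART W 105/105, PART D 704/704) and p6 g7 X2-WEILPURITY-E-p6g7.md 6348f244af71037e (PART E 216/216)),
l.5653–5947; = theory/th7/PurityRank.lean v1 10469e30f4503d5e section PurityGeneral, ×2 p6 g5 X2-PURITYRANK-p6g5.md: 30/30 exact ranks), VERBATIM up to the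
namespace (`HSemiregBox` ↦ `Summit.Ventures.HSemireg.WedgeBox`; it sits after `WedgeBoxAll.lean`'s `end AllDegrees` in th-7's file), file 2 of 2.
STATEMENT (file 2, `finrank_range_wedgeMap_hbox_degree_n`): for `v = Σ_{α,β} c_{αβ} · E_{A_α} ∧ E_{C_β}` with all four `c_{αβ} ≠ 0`,
`rank(θ ↦ θ ∧ v ∣ ⋀ⁿ K^{4n}) + 4 + 2·[c₀₀c₁₁ = c₀₁c₁₀] = 4·C(2n,n)` (every field, every `n ≥ 1`; `n = 2`: `18 ∣ 20` = `_two_two`) —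
FORMULA-N PART B §L.5 / STRUCTURE C16 (the generic value `4·C(2n,n) − 4` drops by exactly two on the determinant locus).  This file: the triple coordinates of the `J`-family, the two separating functionals `ψA`/`ψC`, the rank ON (`_of_det`) and OFF (`_of_not_det`) the determinant locus, **`finrank_range_wedgeMap_hbox_degree_n`**, `_two_two`.
-/

open Module Set Set.powersetCard

namespace Summit.Ventures.HSemireg.WedgeBox

variable (K : Type*) [Field K] {n : ℕ}

section PurityGeneral

variable (c : Fin 2 → Fin 2 → K)

/-- a `J`-monomial other than `A₀` has zero coordinate at both `A`-side triple monomials. -/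
lemma coord_TA_vecJ (s : J n) (hs0 : s.1 ≠ A n 0) (β : Fin 2) :
    (B K n).coord (TA n β) (vecJ K (hboxCoeff K (n := n) c) s) = 0 := by
  classical
  obtain ⟨hsRel, hsA1, _⟩ := mem_J.mp s.2
  rw [vecJ, vec, coord_B_mul_boxClass]
  refine Finset.sum_eq_zero fun α' _ => Finset.sum_eq_zero fun β' _ => ?_
  by_cases hd : Disjoint (relPc (n := n) (jRel s)).val (P n α' β')
  · rw [if_neg, mul_zero]
    intro he
    have hsA := eq_A_of_union_eq_TA (card_of_mem_Rel hsRel) he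
    change s.1 = A n (other α') at hsA
    by_cases hα : α' = 0
    · subst hα; rw [other_zero] at hsA; exact hsA1 hsA
    · have hα1 : α' = 1 := by omega
      subst hα1; rw [other_one] at hsA; exact hs0 hsA
  · rw [sgn_of_not_disjoint K hd, mul_zero, zero_mul]

/-- a `J`-monomial other than `C₀` has zero coordinate at both `C`-side triple monomials. -/
lemma coord_TC_vecJ (s : J n) (hs0 : s.1 ≠ C n 0) (α : Fin 2) :
    (B K n).coord (TC n α) (vecJ K (hboxCoeff K (n := n) c) s) = 0 := by
  classical
  obtain ⟨hsRel, _, hsC1⟩ := mem_J.mp s.2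
  rw [vecJ, vec, coord_B_mul_boxClass]
  refine Finset.sum_eq_zero fun α' _ => Finset.sum_eq_zero fun β' _ => ?_
  by_cases hd : Disjoint (relPc (n := n) (jRel s)).val (P n α' β')
  · rw [if_neg, mul_zero]
    intro he
    have hsC := eq_C_of_union_eq_TC (card_of_mem_Rel hsRel) he
    change s.1 = C n (other β') at hsC
    by_cases hβ : β' = 0
    · subst hβ; rw [other_zero] at hsC; exact hsC1 hsC
    · have hβ1 : β' = 1 := by omega
      subst hβ1; rw [other_one] at hsC; exact hs0 hsC
  · rw [sgn_of_not_disjoint K hd, mul_zero, zero_mul]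

/-! #### The corner vectors as members of the `vec`-family. -/

/-- the `vec`-family member at the whole block `A α` is `E_{A α} ∧ hbox c`. -/
lemma vec_A_eq (α : Fin 2) :
    vec K (hboxCoeff K (n := n) c) ⟨A n α, A_mem_Rel α⟩ =
      B K n (Apc n α : powersetCard (I n) n) * hbox K n c := by
  rw [vec, hbox_eq_boxClass]
  congr 1

/-- the `vec`-family member at the whole block `C β` is `E_{C β} ∧ hbox c`. -/
lemma vec_C_eq (β : Fin 2) :
    vec K (hboxCoeff K (n := n) c) ⟨C n β, C_mem_Rel β⟩ =
      B K n (Cpc n β : powersetCard (I n) n) * hbox K n c := by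
  rw [vec, hbox_eq_boxClass]
  congr 1

/-- the `J`-family member at `A 0` is `E_{A 0} ∧ hbox c`. -/
lemma vecJ_A_zero (hn : 0 < n) :
    vecJ K (hboxCoeff K (n := n) c) ⟨A n 0, A_zero_mem_J hn⟩ =
      B K n (Apc n 0 : powersetCard (I n) n) * hbox K n c :=
  vec_A_eq K c 0

/-- the `J`-family member at `C 0` is `E_{C 0} ∧ hbox c`. -/
lemma vecJ_C_zero (hn : 0 < n) :
    vecJ K (hboxCoeff K (n := n) c) ⟨C n 0, C_zero_mem_J hn⟩ =
      B K n (Cpc n 0 : powersetCard (I n) n) * hbox K n c :=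
  vec_C_eq K c 0

/-! #### The two separating functionals. -/

/-- kills the span of the `J`-family, detects `E_{A₁} ∧ v` off the determinant locus. -/
noncomputable def ψA : Module.Dual K (HT K n) :=
  (c 1 1 * uA K (n := n) 1) • (B K n).coord (TA n 0) - (c 1 0 * uA K (n := n) 0) • (B K n).coord (TA n 1)

/-- kills the span of the `J`-family and `E_{A₁} ∧ v`, detects `E_{C₁} ∧ v` off the determinant locus. -/
noncomputable def ψC : Module.Dual K (HT K n) :=
  (c 1 1 * uC K (n := n) 1) • (B K n).coord (TC n 0) - (c 0 1 * uC K (n := n) 0) • (B K n).coord (TC n 1)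

/-- the separating functional `ψA` written out in the two `A`-side triple coordinates. -/
lemma ψA_apply (x : HT K n) :
    ψA K c x = c 1 1 * uA K (n := n) 1 * (B K n).coord (TA n 0) x -
      c 1 0 * uA K (n := n) 0 * (B K n).coord (TA n 1) x := by
  rw [ψA, LinearMap.sub_apply, LinearMap.smul_apply, LinearMap.smul_apply, smul_eq_mul, smul_eq_mul]

/-- the separating functional `ψC` written out in the two `C`-side triple coordinates. -/
lemma ψC_apply (x : HT K n) :
    ψC K c x = c 1 1 * uC K (n := n) 1 * (B K n).coord (TC n 0) x -
      c 0 1 * uC K (n := n) 0 * (B K n).coord (TC n 1) x := by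
  rw [ψC, LinearMap.sub_apply, LinearMap.smul_apply, LinearMap.smul_apply, smul_eq_mul, smul_eq_mul]

/-- `ψA` kills `E_{A 0} ∧ hbox c`. -/
lemma ψA_vA_zero (hn : 0 < n) : ψA K c (B K n (Apc n 0 : powersetCard (I n) n) * hbox K n c) = 0 := by
  rw [ψA_apply, vA_zero_eq K hn c, coord_TA_sum_TA K hn, coord_TA_sum_TA K hn]
  ring

/-- `ψA (E_{A 1} ∧ hbox c)` is a unit times `det c = c₀₀c₁₁ − c₀₁c₁₀`. -/
lemma ψA_vA_one (hn : 0 < n) :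
    ψA K c (B K n (Apc n 1 : powersetCard (I n) n) * hbox K n c) =
      (-1 : K) ^ (n * n) * (uA K (n := n) 0 * uA K (n := n) 1) * (c 0 0 * c 1 1 - c 0 1 * c 1 0) := by
  rw [ψA_apply, vA_one_eq K hn c, coord_TA_sum_TA K hn, coord_TA_sum_TA K hn]
  ring

/-- `ψA` kills every member of the `J`-family. -/
lemma ψA_vecJ (hn : 0 < n) (s : J n) : ψA K c (vecJ K (hboxCoeff K (n := n) c) s) = 0 := by
  by_cases hs0 : s.1 = A n 0
  · have : s = ⟨A n 0, A_zero_mem_J hn⟩ := Subtype.ext hs0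
    rw [this, vecJ_A_zero K c hn, ψA_vA_zero K c hn]
  · rw [ψA_apply, coord_TA_vecJ K c s hs0, coord_TA_vecJ K c s hs0, mul_zero, mul_zero, sub_zero]

/-- `ψC` kills `E_{C 0} ∧ hbox c`. -/
lemma ψC_vC_zero (hn : 0 < n) : ψC K c (B K n (Cpc n 0 : powersetCard (I n) n) * hbox K n c) = 0 := by
  rw [ψC_apply, vC_zero_eq K hn c, coord_TC_sum_TC K hn, coord_TC_sum_TC K hn]
  ring

/-- `ψC (E_{C 1} ∧ hbox c)` is a unit times `det c = c₀₀c₁₁ − c₀₁c₁₀`. -/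
lemma ψC_vC_one (hn : 0 < n) :
    ψC K c (B K n (Cpc n 1 : powersetCard (I n) n) * hbox K n c) =
      (-1 : K) ^ (n * n) * (uC K (n := n) 0 * uC K (n := n) 1) * (c 0 0 * c 1 1 - c 0 1 * c 1 0) := by
  rw [ψC_apply, vC_one_eq K hn c, coord_TC_sum_TC K hn, coord_TC_sum_TC K hn]
  ring

/-- `ψC` kills `E_{A 1} ∧ hbox c`. -/
lemma ψC_vA_one (hn : 0 < n) : ψC K c (B K n (Apc n 1 : powersetCard (I n) n) * hbox K n c) = 0 := by
  rw [ψC_apply, vA_one_eq K hn c, coord_TC_sum_TA K hn, coord_TC_sum_TA K hn, mul_zero, mul_zero, sub_zero]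

/-- `ψC` kills every member of the `J`-family. -/
lemma ψC_vecJ (hn : 0 < n) (s : J n) : ψC K c (vecJ K (hboxCoeff K (n := n) c) s) = 0 := by
  by_cases hs0 : s.1 = C n 0
  · have : s = ⟨C n 0, C_zero_mem_J hn⟩ := Subtype.ext hs0
    rw [this, vecJ_C_zero K c hn, ψC_vC_zero K c hn]
  · rw [ψC_apply, coord_TC_vecJ K c s hs0, coord_TC_vecJ K c s hs0, mul_zero, mul_zero, sub_zero]

/-! #### The rank on and off the determinant locus. -/

/-- the exterior algebra of `K^{4n}` is finite-dimensional (monomial basis). -/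
instance instFiniteHT : Module.Finite K (HT K n) := Module.Finite.of_basis (B K n)

/-- the range of `θ ↦ θ ∧ v` on `⋀^n` for the honest box with general `c`. -/
lemma range_hbox_eq :
    LinearMap.range (wedgeMap K n n (hbox K n c)) =
      Submodule.span K (Set.range (vec K (n := n) (k := n) (hboxCoeff K (n := n) c))) := by
  rw [hbox_eq_boxClass, range_eq_span_vec]

/-- the span of the `J`-family lies in the range of `θ ↦ θ ∧ hbox c` on `⋀ⁿ`. -/
lemma span_vecJ_le_range :
    Submodule.span K (Set.range (vecJ K (n := n) (hboxCoeff K (n := n) c))) ≤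
      LinearMap.range (wedgeMap K n n (hbox K n c)) := by
  rw [range_hbox_eq]
  apply Submodule.span_mono
  rintro _ ⟨s, rfl⟩
  exact ⟨jRel s, rfl⟩

/-- the `J`-family is linearly independent: its span has dimension `card J` (all `c α β ≠ 0`, `n > 0`). -/
lemma finrank_span_vecJ (hn : 0 < n) (hc : ∀ α β, c α β ≠ 0) :
    Module.finrank K (Submodule.span K (Set.range (vecJ K (n := n) (hboxCoeff K (n := n) c)))) = (J n).card := by
  rw [finrank_span_eq_card (vecJ_linearIndependent K _ hn (hboxCoeff_ne_zero K hc)), Fintype.card_coe]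

/-- upper bound: the range is spanned by `card (Rel n n) = card J + 2` vectors. -/
lemma finrank_range_hbox_le (hn : 0 < n) :
    Module.finrank K (LinearMap.range (wedgeMap K n n (hbox K n c))) ≤ (J n).card + 2 := by
  rw [range_hbox_eq, card_J hn, ← Fintype.card_coe]
  exact finrank_range_le_card _

/-- ON the determinant locus: the range IS the span of the `J`-family. -/
lemma range_hbox_eq_span_vecJ_of_det (hn : 0 < n) (hc : ∀ α β, c α β ≠ 0)
    (hdet : c 0 0 * c 1 1 = c 0 1 * c 1 0) :
    LinearMap.range (wedgeMap K n n (hbox K n c)) =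
      Submodule.span K (Set.range (vecJ K (n := n) (hboxCoeff K (n := n) c))) := by
  apply le_antisymm _ (span_vecJ_le_range K c)
  rw [range_hbox_eq, Submodule.span_le]
  rintro _ ⟨s, rfl⟩
  rw [SetLike.mem_coe]
  by_cases hJ : s.1 ∈ J n
  · exact Submodule.subset_span ⟨⟨s.1, hJ⟩, rfl⟩
  · have hs : s.1 = A n 1 ∨ s.1 = C n 1 := by
      have := s.2
      rw [mem_J, not_and, not_and_or, not_not, not_not] at hJ
      exact hJ this
    rcases hs with hs | hs
    · -- E_{A1} ∧ v is a multiple of E_{A0} ∧ v on the locus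
      have hsA : s = ⟨A n 1, A_mem_Rel 1⟩ := Subtype.ext hs
      have hrel : c 0 1 = c 0 0 * c 1 1 * (c 1 0)⁻¹ := by
        rw [hdet, mul_assoc, mul_inv_cancel₀ (hc 1 0), mul_one]
      have hv : vec K (hboxCoeff K (n := n) c) s =
          ((-1 : K) ^ (n * n) * c 0 0 * (c 1 0)⁻¹) • vecJ K (hboxCoeff K (n := n) c) ⟨A n 0, A_zero_mem_J hn⟩ := by
        rw [hsA, vec_A_eq, vecJ_A_zero K c hn, vA_one_eq K hn c, vA_zero_eq K hn c, Finset.smul_sum,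
          Fin.sum_univ_two, Fin.sum_univ_two, smul_smul, smul_smul, hrel]
        congr 1
        · rw [show (-1 : K) ^ (n * n) * c 0 0 * (c 1 0)⁻¹ * (c 1 0 * uA K (n := n) 0) =
            (-1 : K) ^ (n * n) * c 0 0 * ((c 1 0)⁻¹ * c 1 0) * uA K (n := n) 0 by ring, inv_mul_cancel₀ (hc 1 0), mul_one]
        · rw [show (-1 : K) ^ (n * n) * (c 0 0 * c 1 1 * (c 1 0)⁻¹) * uA K (n := n) 1 =
            (-1 : K) ^ (n * n) * c 0 0 * (c 1 0)⁻¹ * (c 1 1 * uA K (n := n) 1) by ring]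
      rw [hv]
      exact Submodule.smul_mem _ _ (Submodule.subset_span ⟨_, rfl⟩)
    · have hsC : s = ⟨C n 1, C_mem_Rel 1⟩ := Subtype.ext hs
      have hrel : c 1 0 = c 0 0 * c 1 1 * (c 0 1)⁻¹ := by
        rw [hdet, mul_comm (c 0 1) (c 1 0), mul_assoc, mul_inv_cancel₀ (hc 0 1), mul_one]
      have hv : vec K (hboxCoeff K (n := n) c) s =
          ((-1 : K) ^ (n * n) * c 0 0 * (c 0 1)⁻¹) • vecJ K (hboxCoeff K (n := n) c) ⟨C n 0, C_zero_mem_J hn⟩ := by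
        rw [hsC, vec_C_eq, vecJ_C_zero K c hn, vC_one_eq K hn c, vC_zero_eq K hn c, Finset.smul_sum,
          Fin.sum_univ_two, Fin.sum_univ_two, smul_smul, smul_smul, hrel]
        congr 1
        · rw [show (-1 : K) ^ (n * n) * c 0 0 * (c 0 1)⁻¹ * (c 0 1 * uC K (n := n) 0) =
            (-1 : K) ^ (n * n) * c 0 0 * ((c 0 1)⁻¹ * c 0 1) * uC K (n := n) 0 by ring, inv_mul_cancel₀ (hc 0 1), mul_one]
        · rw [show (-1 : K) ^ (n * n) * (c 0 0 * c 1 1 * (c 0 1)⁻¹) * uC K (n := n) 1 =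
            (-1 : K) ^ (n * n) * c 0 0 * (c 0 1)⁻¹ * (c 1 1 * uC K (n := n) 1) by ring]
      rw [hv]
      exact Submodule.smul_mem _ _ (Submodule.subset_span ⟨_, rfl⟩)

/-- ON the determinant locus: `rank + 6 = 4·C(2n,n)` (Part II's box value, now for every singular `c`). -/
theorem finrank_range_wedgeMap_hbox_of_det (hn : 0 < n) (hc : ∀ α β, c α β ≠ 0)
    (hdet : c 0 0 * c 1 1 = c 0 1 * c 1 0) :
    Module.finrank K (LinearMap.range (wedgeMap K n n (hbox K n c))) + 6 = 4 * (n + n).choose n := by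
  rw [range_hbox_eq_span_vecJ_of_det K c hn hc hdet, finrank_span_vecJ K c hn hc]
  have h1 := card_J (n := n) hn
  have h2 := card_Rel (n := n) (k := n) hn
  rw [Nat.choose_self] at h2
  omega

/-- OFF the determinant locus: `rank + 4 = 4·C(2n,n)` (the generic value). -/
theorem finrank_range_wedgeMap_hbox_of_not_det (hn : 0 < n) (hc : ∀ α β, c α β ≠ 0)
    (hdet : c 0 0 * c 1 1 ≠ c 0 1 * c 1 0) :
    Module.finrank K (LinearMap.range (wedgeMap K n n (hbox K n c))) + 4 = 4 * (n + n).choose n := by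
  set R := LinearMap.range (wedgeMap K n n (hbox K n c)) with hR
  set S0 := Submodule.span K (Set.range (vecJ K (n := n) (hboxCoeff K (n := n) c))) with hS0
  set vA1 := B K n (Apc n 1 : powersetCard (I n) n) * hbox K n c with hvA1
  set vC1 := B K n (Cpc n 1 : powersetCard (I n) n) * hbox K n c with hvC1
  have hdet' : c 0 0 * c 1 1 - c 0 1 * c 1 0 ≠ 0 := sub_ne_zero.mpr hdet
  have hsign : (-1 : K) ^ (n * n) ≠ 0 := pow_ne_zero _ (neg_ne_zero.mpr one_ne_zero)
  -- membership of the two extra vectors in the range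
  have hA1R : vA1 ∈ R := by
    rw [hR, range_hbox_eq, hvA1, ← vec_A_eq K c 1]
    exact Submodule.subset_span ⟨_, rfl⟩
  have hC1R : vC1 ∈ R := by
    rw [hR, range_hbox_eq, hvC1, ← vec_C_eq K c 1]
    exact Submodule.subset_span ⟨_, rfl⟩
  -- S0 ≤ ker ψA, ker ψC
  have hS0A : S0 ≤ LinearMap.ker (ψA K c) := by
    rw [hS0, Submodule.span_le]
    rintro _ ⟨s, rfl⟩
    rw [SetLike.mem_coe, LinearMap.mem_ker]
    exact ψA_vecJ K c hn s
  have hS0C : S0 ≤ LinearMap.ker (ψC K c) := by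
    rw [hS0, Submodule.span_le]
    rintro _ ⟨s, rfl⟩
    rw [SetLike.mem_coe, LinearMap.mem_ker]
    exact ψC_vecJ K c hn s
  -- the chain S0 < S1 < S2 ≤ R
  set S1 := S0 ⊔ K ∙ vA1 with hS1
  set S2 := S1 ⊔ K ∙ vC1 with hS2
  have hA1S0 : vA1 ∉ S0 := by
    intro h
    have := LinearMap.mem_ker.mp (hS0A h)
    rw [hvA1, ψA_vA_one K c hn] at this
    exact mul_ne_zero (mul_ne_zero hsign (mul_ne_zero (uA_ne_zero K 0) (uA_ne_zero K 1))) hdet' this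
  have hS1C : S1 ≤ LinearMap.ker (ψC K c) := by
    rw [hS1]
    refine sup_le hS0C ?_
    rw [Submodule.span_le, Set.singleton_subset_iff, SetLike.mem_coe, LinearMap.mem_ker, hvA1]
    exact ψC_vA_one K c hn
  have hC1S1 : vC1 ∉ S1 := by
    intro h
    have := LinearMap.mem_ker.mp (hS1C h)
    rw [hvC1, ψC_vC_one K c hn] at this
    exact mul_ne_zero (mul_ne_zero hsign (mul_ne_zero (uC_ne_zero K 0) (uC_ne_zero K 1))) hdet' this
  have h01 : S0 < S1 := by
    refine lt_of_le_of_ne le_sup_left fun h => hA1S0 ?_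
    rw [h]; exact Submodule.mem_sup_right (Submodule.mem_span_singleton_self _)
  have h12 : S1 < S2 := by
    refine lt_of_le_of_ne le_sup_left fun h => hC1S1 ?_
    rw [h]; exact Submodule.mem_sup_right (Submodule.mem_span_singleton_self _)
  have hS2R : S2 ≤ R := by
    rw [hS2, hS1]
    refine sup_le (sup_le ?_ ?_) ?_
    · rw [hS0, hR]; exact span_vecJ_le_range K c
    · rw [Submodule.span_le, Set.singleton_subset_iff]; exact hA1R
    · rw [Submodule.span_le, Set.singleton_subset_iff]; exact hC1R
  have f0 : Module.finrank K S0 = (J n).card := by rw [hS0]; exact finrank_span_vecJ K c hn hc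
  have f01 := Submodule.finrank_lt_finrank_of_lt h01
  have f12 := Submodule.finrank_lt_finrank_of_lt h12
  have f2R := Submodule.finrank_mono hS2R
  have fR := finrank_range_hbox_le K c hn
  have h1 := card_J (n := n) hn
  have h2 := card_Rel (n := n) (k := n) hn
  rw [Nat.choose_self] at h2
  rw [← hR] at fR
  omega

open Classical in
/-- **THE PURITY LOCUS (FORMULA-N PART B §L.5, STRUCTURE C16), wedge model, every `n ≥ 1`, every field**: for the honest
box `v = Σ c_{αβ} E_{A_α} ∧ E_{C_β}` with all four coefficients non-zero, the rank of `θ ↦ θ ∧ v` on `⋀^n(K^{4n})` satisfies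
`rank + 4 + 2·[c₀₀c₁₁ = c₀₁c₁₀] = 4·C(2n,n)` — generic value `4·C(2n,n) − 4`, dropping by exactly two on the determinant
locus (the box / decomposable case). -/
theorem finrank_range_wedgeMap_hbox_degree_n (hn : 0 < n) (hc : ∀ α β, c α β ≠ 0) :
    Module.finrank K (LinearMap.range (wedgeMap K n n (hbox K n c))) + 4 +
      2 * (if c 0 0 * c 1 1 = c 0 1 * c 1 0 then 1 else 0) = 4 * (n + n).choose n := by
  split_ifs with hdet
  · have := finrank_range_wedgeMap_hbox_of_det K c hn hc hdet
    omega
  · have := finrank_range_wedgeMap_hbox_of_not_det K c hn hc hdet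
    omega

open Classical in
/-- the STEP-0 / T4a numbers: `n = 2`, degree `2` — rank `18` on the locus, `20` off it. -/
theorem finrank_range_wedgeMap_hbox_two_two {c : Fin 2 → Fin 2 → K} (hc : ∀ α β, c α β ≠ 0) :
    Module.finrank K (LinearMap.range (wedgeMap K 2 2 (hbox K 2 c))) =
      if c 0 0 * c 1 1 = c 0 1 * c 1 0 then 18 else 20 := by
  have h := finrank_range_wedgeMap_hbox_degree_n K (n := 2) c (by norm_num) hc
  have e : (2 + 2).choose 2 = 6 := by decide
  rw [e] at h
  split_ifs at h ⊢ with hdet <;> omega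

end PurityGeneral

end Summit.Ventures.HSemireg.WedgeBox
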